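import Summits.AnomalousDissipation.AnomalousDissipation.Theorems.MomentParityQuarticGateAxialDefectTranslate
import Literature.Analysis.FluidPDE.BeltramiWavesCurl

/-!
# Stub `stub_axialDefect` (S5a) of the line `axis-sectors`
# (crux `MomentParity.QuarticGate`, stmt-AnomalousDissipation-11464)

**The lever at order 2: a shear-symmetric law only sees axial quadratic Casimirs.** Let `f` be a
smooth force invariant under the shear translations `G′ = {a : T³ | a 1 = 0}`, and `μ₀` a level-`N`
probability law on `H` with bounded support whose cylindrical statistics are invariant in law under
the finite shear torsion group `H_L = {a | a 1 = 0, L • a = 0}`, whose ENERGY row and HELICITY row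
vanish, at a level where AXIAL QuadRigidity holds (every `H_L`-invariant homogeneous quadratic
Casimir has `∇p = 2α P_N u + 2β curl P_N u`; the conclusion of `stub_axialQuadRigidity`, taken as a
hypothesis). Then the row `u ↦ ⟨F(u), ∇p₂(u)⟩` of EVERY homogeneous quadratic Casimir `p₂` is
`μ₀`-integrable with mean zero (`stub_axialDefect`, statement byte-for-byte the registered stub of
`Cruxes/QuarticGate/Lines/axis-sectors.lean`).

Proof (`axialDefect_basis`, in an orthonormal band basis `b` of `V_N`, `exists_bandBasis`; the test
is transported there by `polyGrad_transport`): average the test over `H_L`,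
`P̄ = |H_L|⁻¹ Σ_{a ∈ H_L} P ∘ ρ(a)` with `ρ(a)` the matrix of the translated basis `b(· + a)` in `b`.
Each `P ∘ ρ(a)` has the differential field of the translated test `(b(· + a), P)`, which is again a
Casimir (`euler_comp_add_right_eq_zero`: its Euler pairing is the same coordinate polynomial, by Haar
invariance of the coefficients, and that polynomial vanishes identically), so `P̄` is a homogeneous
quadratic Casimir; it is `H_L`-invariant by reindexing the average over the finite group
(`finite_shearTorsion`). Axial QuadRigidity then makes its row `2α·(energy row) + 2β·(helicity row)
= 0`. Finally every translate has the same mean row as `P` (`integral_row_comp_add_right`: the row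
is a fixed coordinate polynomial, `row_eq_eval`, integrated against `H_L`-invariant coordinate laws),
so `∫ row(p₂) dμ₀ = ∫ row(p̄₂) dμ₀ = 0`. Integrability: bounded support and `exists_rowPoly`.
-/

-- `Summit.<Summit>.<Problem>` is the tree's mandated summit-side namespace (CONVENTIONS §2); for this
-- single-conjunct summit the two coincide, so the duplicate is deliberate.
set_option linter.dupNamespace false

namespace Summit.AnomalousDissipation.AnomalousDissipation.Theorems.MomentParityQuarticGate

open MeasureTheory Filter MvPolynomial
open scoped InnerProductSpace RealInnerProductSpace ENNReal
open Literature.Analysis.FunctionSpaces Literature.Analysis.FluidPDE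
open Summit.AnomalousDissipation.AnomalousDissipation.Theses.MomentParity
open Summit.AnomalousDissipation.AnomalousDissipation.Theorems.QuarticGate.Negative

namespace AxialDefect

variable {N n : ℕ} {b : Fin n → UnitAddTorus (Fin 3) → EuclideanSpace ℝ (Fin 3)}

/-! ## S5a in a band basis -/

/-- **S5a in an orthonormal band basis.** For an orthonormal band basis `b` of `V_N`, a smooth
shear-invariant force, a level-`N` probability law `μ₀` with bounded support whose coordinate
statistics are `H_L`-invariant in law (`L > 0`), whose energy and helicity rows vanish, and axial
QuadRigidity for tests over `b` (hypothesis): every homogeneous quadratic Casimir `(b, P)` has an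
integrable row with mean zero. Proof: average `P` over the finite shear torsion group `H_L`
(`P̄ = |H_L|⁻¹ Σ_a P ∘ ρ(a)`, `ρ(a)` the matrix of `b(· + a)` in `b`); `P̄` is again a homogeneous
quadratic Casimir (`euler_comp_add_right_eq_zero`) and `H_L`-invariant by reindexing the average, so
axial QuadRigidity makes its row `2α·(energy row) + 2β·(helicity row) = 0`; and every translate has
the same mean row (`integral_row_comp_add_right`). [folklore] -/
theorem axialDefect_basis
    (hb : ∀ i, Torus.IsSmooth (b i) ∧ Torus.IsDivFree (b i) ∧ Torus.HasZeroMean (b i) ∧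
      ∀ k ∉ (Torus.freqBall N).erase (0 : Fin 3 → ℤ),
        UnitAddTorus.mFourierCoeff (EuclideanSpace.complexify ∘ (b i)) k = 0)
    (hbo : ∀ i j, ∫ x, ⟪b i x, b j x⟫_ℝ = if i = j then (1 : ℝ) else 0)
    (hbs : ∀ u : Torus.energySpace (Fin 3),
      (∀ k ∉ (Torus.freqBall N).erase (0 : Fin 3 → ℤ),
        UnitAddTorus.mFourierCoeff (EuclideanSpace.complexify ∘
          (u.1 : UnitAddTorus (Fin 3) → EuclideanSpace ℝ (Fin 3))) k = 0) →
      ∀ x, Torus.fourierTruncate N (u.1 : UnitAddTorus (Fin 3) → EuclideanSpace ℝ (Fin 3)) x =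
        ∑ i, Torus.pairing u.1 (b i) • b i x)
    (ν : ℝ) {f : UnitAddTorus (Fin 3) → EuclideanSpace ℝ (Fin 3)} (hf : Torus.IsSmooth f)
    (hfsym : ∀ a : UnitAddTorus (Fin 3), a 1 = 0 → ∀ x, f (x + a) = f x) {L : ℕ} (hL : 0 < L)
    (μ₀ : Measure (Torus.energySpace (Fin 3))) [IsProbabilityMeasure μ₀]
    (hl₀ : ∀ᵐ u ∂μ₀, IsLevel N u) {R : ℝ} (hR : ∀ᵐ u ∂μ₀, ‖u‖ ≤ R)
    (hsym : ∀ a : UnitAddTorus (Fin 3), a 1 = 0 → L • a = 0 →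
      Measure.map (fun u : Torus.energySpace (Fin 3) => fun i =>
          Torus.pairing u.1 (fun x => b i (x + a))) μ₀ =
        Measure.map (fun u : Torus.energySpace (Fin 3) => fun i => Torus.pairing u.1 (b i)) μ₀)
    (hE : Integrable (fun u : Torus.energySpace (Fin 3) => Torus.nsGeneratorPairing ν f u
        (Torus.fourierTruncate N (u.1 : UnitAddTorus (Fin 3) → EuclideanSpace ℝ (Fin 3)))) μ₀ ∧
      ∫ u : Torus.energySpace (Fin 3), Torus.nsGeneratorPairing ν f u
        (Torus.fourierTruncate N (u.1 : UnitAddTorus (Fin 3) → EuclideanSpace ℝ (Fin 3))) ∂μ₀ = 0)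
    (hH : Integrable (fun u : Torus.energySpace (Fin 3) => Torus.nsGeneratorPairing ν f u
        (BDSV.curl (Torus.fourierTruncate N (u.1 : UnitAddTorus (Fin 3) → EuclideanSpace ℝ (Fin 3))))) μ₀ ∧
      ∫ u : Torus.energySpace (Fin 3), Torus.nsGeneratorPairing ν f u
        (BDSV.curl (Torus.fourierTruncate N (u.1 : UnitAddTorus (Fin 3) → EuclideanSpace ℝ (Fin 3)))) ∂μ₀ = 0)
    (hQuad : ∀ P : MvPolynomial (Fin n) ℝ, P.IsHomogeneous 2 →
      (∀ a : UnitAddTorus (Fin 3), a 1 = 0 → L • a = 0 → ∀ u : Torus.energySpace (Fin 3), IsLevel N u →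
        MvPolynomial.eval (fun j => Torus.pairing u.1 (fun x => b j (x + a))) P =
          MvPolynomial.eval (fun j => Torus.pairing u.1 (b j)) P) →
      (∀ u : Torus.energySpace (Fin 3), IsLevel N u →
        Torus.nsGeneratorPairing (d := Fin 3) 0 0 u (polyGrad b P u) = 0) →
      ∃ α β : ℝ, ∀ u : Torus.energySpace (Fin 3), IsLevel N u →
        ∀ x, polyGrad b P u x =
          (2 * α) • Torus.fourierTruncate N (u.1 : UnitAddTorus (Fin 3) → EuclideanSpace ℝ (Fin 3)) x +
          (2 * β) • BDSV.curl (Torus.fourierTruncate N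
            (u.1 : UnitAddTorus (Fin 3) → EuclideanSpace ℝ (Fin 3))) x)
    (P : MvPolynomial (Fin n) ℝ) (hP : P.IsHomogeneous 2)
    (hC : ∀ u : Torus.energySpace (Fin 3), IsLevel N u →
      Torus.nsGeneratorPairing (d := Fin 3) 0 0 u (polyGrad b P u) = 0) :
    Integrable (fun u : Torus.energySpace (Fin 3) =>
        Torus.nsGeneratorPairing ν f u (polyGrad b P u)) μ₀ ∧
      ∫ u, Torus.nsGeneratorPairing ν f u (polyGrad b P u) ∂μ₀ = 0 := by
  classical
  have hbsm : ∀ i, Torus.IsSmooth (b i) := fun i => (hb i).1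
  have hint : ∀ P' : MvPolynomial (Fin n) ℝ, Integrable (fun u : Torus.energySpace (Fin 3) =>
      Torus.nsGeneratorPairing ν f u (polyGrad b P' u)) μ₀ := fun P' =>
    integrable_row_of_bounded hb hbo hbs ν hf μ₀ hl₀ hR P'
  refine ⟨hint P, ?_⟩
  -- the finite shear torsion group
  set Hs : Finset (UnitAddTorus (Fin 3)) := (finite_shearTorsion hL).toFinset with hHs
  have hmem : ∀ a, a ∈ Hs ↔ a 1 = 0 ∧ L • a = 0 := fun a => by
    rw [hHs, Set.Finite.mem_toFinset, Set.mem_setOf_eq]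
  have h0 : (0 : UnitAddTorus (Fin 3)) ∈ Hs := (hmem 0).2 ⟨rfl, smul_zero _⟩
  have hcard : (Hs.card : ℝ) ≠ 0 := Nat.cast_ne_zero.2 (Finset.card_pos.2 ⟨0, h0⟩).ne'
  -- translated bases and their coefficient matrices
  have hb' : ∀ (a : UnitAddTorus (Fin 3)) i, Torus.IsSmooth (fun y => b i (y + a)) ∧
      Torus.IsDivFree (fun y => b i (y + a)) ∧ Torus.HasZeroMean (fun y => b i (y + a)) ∧
      ∀ k ∉ (Torus.freqBall N).erase (0 : Fin 3 → ℤ),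
        UnitAddTorus.mFourierCoeff (EuclideanSpace.complexify ∘ fun y => b i (y + a)) k = 0 :=
    fun a i => band_comp_add_right (hb i) a
  set ρ : UnitAddTorus (Fin 3) → Fin n → Fin n → ℝ := fun a j i => ∫ y, ⟪b j (y + a), b i y⟫_ℝ with hρ
  set Pa : UnitAddTorus (Fin 3) → MvPolynomial (Fin n) ℝ := fun a =>
    bind₁ (fun j => ∑ i, C (ρ a j i) * X i) P with hPa
  -- transport: `(b, P ∘ ρ(a))` has the differential field of `(b(·+a), P)`
  have htr : ∀ (a : UnitAddTorus (Fin 3)) (u : Torus.energySpace (Fin 3)),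
      polyGrad b (Pa a) u = polyGrad (fun i y => b i (y + a)) P u := by
    intro a u
    funext x
    exact (polyGrad_transport (b := b) (g := fun i y => b i (y + a)) (ρ a)
      (fun j z => band_eq_sum_smul hbs (hb' a j) z)
      (fun v j => pairing_band_eq_sum hb hbs (hb' a j) v) P u x).symm
  -- the observable of `P ∘ ρ(a)` is the translate of the observable of `P`
  have hobs : ∀ (a c : UnitAddTorus (Fin 3)) (u : Torus.energySpace (Fin 3)),
      MvPolynomial.eval (fun j => Torus.pairing u.1 (fun x => b j (x + c))) (Pa a) =
        MvPolynomial.eval (fun j => Torus.pairing u.1 (fun x => b j (x + (a + c)))) P := by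
    intro a c u
    rw [hPa, eval_bind₁_linear]
    refine congrArg (fun z : Fin n → ℝ => MvPolynomial.eval z P) (funext fun j => ?_)
    rw [pairing_band_eq_sum (hb' c) (fourierTruncate_eq_sum_comp_add_right hb hbs c) (hb' (a + c) j) u]
    refine Finset.sum_congr rfl fun i _ => ?_
    simp only [hρ, integral_inner_comp_add_right_add]
  have hobs0 : ∀ (a : UnitAddTorus (Fin 3)) (u : Torus.energySpace (Fin 3)),
      MvPolynomial.eval (fun j => Torus.pairing u.1 (b j)) (Pa a) =
        MvPolynomial.eval (fun j => Torus.pairing u.1 (fun x => b j (x + a))) P := by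
    intro a u
    have h := hobs a 0 u
    simp only [add_zero] at h
    exact h
  -- the averaged test
  set w : UnitAddTorus (Fin 3) → ℝ := fun _ => (Hs.card : ℝ)⁻¹ with hw
  set Pbar : MvPolynomial (Fin n) ℝ := ∑ a ∈ Hs, w a • Pa a with hPbar
  have hPbar2 : Pbar.IsHomogeneous 2 := by
    refine IsHomogeneous.sum Hs _ 2 fun a _ => ?_
    rw [smul_eq_C_mul]
    simpa using (isHomogeneous_C _ (w a)).mul
      (isHomogeneous_bind₁ (fun j => isHomogeneous_sum_C_mul_X _ _ _) hP)
  -- `P̄` is a Casimir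
  have hCbar : ∀ u : Torus.energySpace (Fin 3), IsLevel N u →
      Torus.nsGeneratorPairing (d := Fin 3) 0 0 u (polyGrad b Pbar u) = 0 := by
    intro u hu
    have h0 : Torus.IsSmooth (0 : UnitAddTorus (Fin 3) → EuclideanSpace ℝ (Fin 3)) :=
      Torus.isSmooth_const 0
    rw [hPbar, nsGeneratorPairing_polyGrad_sum_smul 0 h0 hbsm Hs w Pa u]
    refine Finset.sum_eq_zero fun a _ => ?_
    rw [htr a u, euler_comp_add_right_eq_zero hb hbo hbs hC a u hu, mul_zero]
  -- `P̄` is `H_L`-invariant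
  have hObs : ∀ a : UnitAddTorus (Fin 3), a 1 = 0 → L • a = 0 →
      ∀ u : Torus.energySpace (Fin 3), IsLevel N u →
        MvPolynomial.eval (fun j => Torus.pairing u.1 (fun x => b j (x + a))) Pbar =
          MvPolynomial.eval (fun j => Torus.pairing u.1 (b j)) Pbar := by
    intro c hc1 hcL u _
    simp only [hPbar, map_sum, smul_eval]
    simp_rw [hobs, hobs0]
    refine Finset.sum_nbij' (fun a => a + c) (fun a => a - c) ?_ ?_ (fun a _ => add_sub_cancel_right a c)
      (fun a _ => sub_add_cancel a c) (fun a _ => rfl)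
    · intro a ha
      obtain ⟨ha1, haL⟩ := (hmem a).1 ha
      refine (hmem _).2 ⟨?_, ?_⟩
      · simp [ha1, hc1]
      · rw [smul_add, haL, hcL, add_zero]
    · intro a ha
      obtain ⟨ha1, haL⟩ := (hmem a).1 ha
      refine (hmem _).2 ⟨?_, ?_⟩
      · simp [ha1, hc1]
      · rw [smul_sub, haL, hcL, sub_zero]
  -- axial QuadRigidity: the row of `P̄` is `2α·(energy row) + 2β·(helicity row)`
  obtain ⟨α, β, hαβ⟩ := hQuad Pbar hPbar2 hObs hCbar
  have hsplit : ∀ u : Torus.energySpace (Fin 3), IsLevel N u →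
      Torus.nsGeneratorPairing ν f u (polyGrad b Pbar u) =
        2 * α * Torus.nsGeneratorPairing ν f u
          (Torus.fourierTruncate N (u.1 : UnitAddTorus (Fin 3) → EuclideanSpace ℝ (Fin 3))) +
        2 * β * Torus.nsGeneratorPairing ν f u
          (BDSV.curl (Torus.fourierTruncate N (u.1 : UnitAddTorus (Fin 3) → EuclideanSpace ℝ (Fin 3)))) := by
    intro u hu
    set wf : Fin 2 → UnitAddTorus (Fin 3) → EuclideanSpace ℝ (Fin 3) :=
      ![Torus.fourierTruncate N (u.1 : UnitAddTorus (Fin 3) → EuclideanSpace ℝ (Fin 3)),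
        BDSV.curl (Torus.fourierTruncate N (u.1 : UnitAddTorus (Fin 3) → EuclideanSpace ℝ (Fin 3)))] with hwf
    set c : Fin 2 → ℝ := ![2 * α, 2 * β] with hc
    have hws : ∀ k ∈ (Finset.univ : Finset (Fin 2)), Torus.IsSmooth (wf k) := by
      intro k _
      fin_cases k
      · exact Torus.isSmooth_fourierTruncate N _
      · exact BDSV.isSmooth_curl (Torus.isSmooth_fourierTruncate N _)
    have hfield : polyGrad b Pbar u = fun x => ∑ k, c k • wf k x := by
      funext x
      rw [hαβ u hu x, Fin.sum_univ_two]
      rfl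
    rw [hfield, Torus.nsGeneratorPairing_sum_smul ν hf.integrable u _ c hws, Fin.sum_univ_two]
    rfl
  have hIbar : ∫ u, Torus.nsGeneratorPairing ν f u (polyGrad b Pbar u) ∂μ₀ = 0 := by
    rw [integral_congr_ae (hl₀.mono hsplit), integral_add (hE.1.const_mul _) (hH.1.const_mul _),
      integral_const_mul, integral_const_mul, hE.2, hH.2, mul_zero, mul_zero, add_zero]
  -- every translate has the same mean row
  have hrows : ∀ a ∈ Hs, ∫ u, Torus.nsGeneratorPairing ν f u (polyGrad b (Pa a) u) ∂μ₀ =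
      ∫ u, Torus.nsGeneratorPairing ν f u (polyGrad b P u) ∂μ₀ := by
    intro a ha
    obtain ⟨ha1, haL⟩ := (hmem a).1 ha
    simp_rw [htr a]
    exact integral_row_comp_add_right hb hbs ν hf (hfsym a ha1) μ₀ hl₀ (hsym a ha1 haL) P
  have hIbar' : ∫ u, Torus.nsGeneratorPairing ν f u (polyGrad b Pbar u) ∂μ₀ =
      ∫ u, Torus.nsGeneratorPairing ν f u (polyGrad b P u) ∂μ₀ := by
    simp_rw [hPbar, nsGeneratorPairing_polyGrad_sum_smul ν hf hbsm Hs w Pa]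
    rw [integral_finsetSum Hs fun a _ => (hint (Pa a)).const_mul (w a)]
    simp_rw [integral_const_mul]
    rw [Finset.sum_congr rfl fun a ha => by rw [hrows a ha]]
    simp only [hw, Finset.sum_const, nsmul_eq_mul]
    rw [← mul_assoc, mul_inv_cancel₀ hcard, one_mul]
  rw [← hIbar', hIbar]

end AxialDefect

/-! ## The theorem, and the registered stub -/

/-- **S5a — a shear-symmetric law only sees axial quadratic Casimirs** (registered sub-goal
`axisSectors_axialDefect` of stmt-AnomalousDissipation-11464: the statement of the stub
`stub_axialDefect` below with its level-separation hypothesis `2 * N < L` weakened to `0 < L`, which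
is all the averaging argument uses — the separation is consumed by axial QuadRigidity, here a
hypothesis). Let `f` be smooth and `G′`-invariant, `μ₀` a level-`N` probability law with bounded
support whose cylindrical statistics are `H_L`-invariant, whose ENERGY row and HELICITY row vanish, at
a level where axial QuadRigidity holds. Then the row of EVERY homogeneous quadratic Casimir is
integrable with mean zero. Proof: transport the test to an orthonormal band basis (`exists_bandBasis`,
`polyGrad_transport`) and apply `AxialDefect.axialDefect_basis`. [folklore] -/
theorem axisSectors_axialDefect :
    ∀ (ν : ℝ) (f : UnitAddTorus (Fin 3) → EuclideanSpace ℝ (Fin 3)) (N L : ℕ)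
      (μ₀ : Measure (Torus.energySpace (Fin 3))),
    Torus.IsSmooth f → (∀ a : UnitAddTorus (Fin 3), a 1 = 0 → ∀ x, f (x + a) = f x) → 0 < L →
    IsProbabilityMeasure μ₀ → (∀ᵐ u ∂μ₀, IsLevel N u) → (∃ R : ℝ, ∀ᵐ u ∂μ₀, ‖u‖ ≤ R) →
    (∀ a : UnitAddTorus (Fin 3), a 1 = 0 → L • a = 0 →
      ∀ (m : ℕ) (g : Fin m → UnitAddTorus (Fin 3) → EuclideanSpace ℝ (Fin 3)),
      (∀ i, IsBandTest N (g i)) →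
      Measure.map (fun u : Torus.energySpace (Fin 3) => fun i => Torus.pairing u.1 (fun x => g i (x + a))) μ₀ =
        Measure.map (fun u : Torus.energySpace (Fin 3) => fun i => Torus.pairing u.1 (g i)) μ₀) →
    (Integrable (fun u : Torus.energySpace (Fin 3) => Torus.nsGeneratorPairing ν f u
        (Torus.fourierTruncate N (u.1 : UnitAddTorus (Fin 3) → EuclideanSpace ℝ (Fin 3)))) μ₀ ∧
      ∫ u : Torus.energySpace (Fin 3), Torus.nsGeneratorPairing ν f u
        (Torus.fourierTruncate N (u.1 : UnitAddTorus (Fin 3) → EuclideanSpace ℝ (Fin 3))) ∂μ₀ = 0) →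
    (Integrable (fun u : Torus.energySpace (Fin 3) => Torus.nsGeneratorPairing ν f u
        (BDSV.curl (Torus.fourierTruncate N (u.1 : UnitAddTorus (Fin 3) → EuclideanSpace ℝ (Fin 3))))) μ₀ ∧
      ∫ u : Torus.energySpace (Fin 3), Torus.nsGeneratorPairing ν f u
        (BDSV.curl (Torus.fourierTruncate N (u.1 : UnitAddTorus (Fin 3) → EuclideanSpace ℝ (Fin 3)))) ∂μ₀ = 0) →
    (∀ (m : ℕ) (g : Fin m → UnitAddTorus (Fin 3) → EuclideanSpace ℝ (Fin 3))
      (P : MvPolynomial (Fin m) ℝ), (∀ i, IsBandTest N (g i)) → P.IsHomogeneous 2 →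
      (∀ a : UnitAddTorus (Fin 3), a 1 = 0 → L • a = 0 → ∀ u : Torus.energySpace (Fin 3), IsLevel N u →
        MvPolynomial.eval (fun j => Torus.pairing u.1 (fun x => g j (x + a))) P =
          MvPolynomial.eval (fun j => Torus.pairing u.1 (g j)) P) →
      (∀ u : Torus.energySpace (Fin 3), IsLevel N u →
        Torus.nsGeneratorPairing (d := Fin 3) 0 0 u (polyGrad g P u) = 0) →
      ∃ α β : ℝ, ∀ u : Torus.energySpace (Fin 3), IsLevel N u →
        ∀ x, polyGrad g P u x =
          (2 * α) • Torus.fourierTruncate N (u.1 : UnitAddTorus (Fin 3) → EuclideanSpace ℝ (Fin 3)) x +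
          (2 * β) • BDSV.curl (Torus.fourierTruncate N
            (u.1 : UnitAddTorus (Fin 3) → EuclideanSpace ℝ (Fin 3))) x) →
    ∀ (m : ℕ) (g : Fin m → UnitAddTorus (Fin 3) → EuclideanSpace ℝ (Fin 3))
      (P : MvPolynomial (Fin m) ℝ), (∀ i, IsBandTest N (g i)) → P.IsHomogeneous 2 →
      (∀ u : Torus.energySpace (Fin 3), IsLevel N u →
        Torus.nsGeneratorPairing (d := Fin 3) 0 0 u (polyGrad g P u) = 0) →
      Integrable (fun u : Torus.energySpace (Fin 3) => Torus.nsGeneratorPairing ν f u (polyGrad g P u)) μ₀ ∧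
      ∫ u, Torus.nsGeneratorPairing ν f u (polyGrad g P u) ∂μ₀ = 0 := by
  intro ν f N L μ₀ hf hfsym hL hp₀ hl₀ hR₀ hsym hE hH hQuad m g P hg hP hC
  obtain ⟨n, b, hb, hbo, hbs⟩ := exists_bandBasis N
  obtain ⟨R, hR⟩ := hR₀
  -- transport the test `(g, P)` to the basis: `(b, P₀)`
  set G : Fin m → Fin n → ℝ := fun j i => ∫ y, ⟪g j y, b i y⟫_ℝ with hG
  set P₀ : MvPolynomial (Fin n) ℝ := bind₁ (fun j => ∑ i, C (G j i) * X i) P with hP₀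
  have htr : ∀ u : Torus.energySpace (Fin 3), polyGrad g P u = polyGrad b P₀ u := fun u =>
    funext (polyGrad_transport G (fun j x => band_eq_sum_smul hbs (hg j) x)
      (fun v j => pairing_band_eq_sum hb hbs (hg j) v) P u)
  have hP₀2 : P₀.IsHomogeneous 2 :=
    isHomogeneous_bind₁ (fun j => isHomogeneous_sum_C_mul_X _ _ _) hP
  have hC₀ : ∀ u : Torus.energySpace (Fin 3), IsLevel N u →
      Torus.nsGeneratorPairing (d := Fin 3) 0 0 u (polyGrad b P₀ u) = 0 := fun u hu => by
    rw [← htr u]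
    exact hC u hu
  have key := AxialDefect.axialDefect_basis hb hbo hbs ν hf hfsym hL μ₀ hl₀ hR
    (fun a ha1 haL => hsym a ha1 haL n b hb) hE hH (fun Q hQ hObs hCQ => hQuad n b Q hb hQ hObs hCQ)
    P₀ hP₀2 hC₀
  simp_rw [htr]
  exact key


/-- **S5a — THE LEVER AT ORDER 2: a shear-symmetric law only sees axial quadratic Casimirs.**
Statement byte-for-byte the registered stub `stub_axialDefect` of
`Cruxes/QuarticGate/Lines/axis-sectors.lean` (line `axis-sectors` of crux `MomentParity.QuarticGate`);
it is `axisSectors_axialDefect` (which only needs `0 < L`). [folklore] -/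
theorem stub_axialDefect :
    ∀ (ν : ℝ) (f : UnitAddTorus (Fin 3) → EuclideanSpace ℝ (Fin 3)) (N L : ℕ)
      (μ₀ : Measure (Torus.energySpace (Fin 3))),
    Torus.IsSmooth f → (∀ a : UnitAddTorus (Fin 3), a 1 = 0 → ∀ x, f (x + a) = f x) → 2 * N < L →
    IsProbabilityMeasure μ₀ → (∀ᵐ u ∂μ₀, IsLevel N u) → (∃ R : ℝ, ∀ᵐ u ∂μ₀, ‖u‖ ≤ R) →
    (∀ a : UnitAddTorus (Fin 3), a 1 = 0 → L • a = 0 →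
      ∀ (m : ℕ) (g : Fin m → UnitAddTorus (Fin 3) → EuclideanSpace ℝ (Fin 3)),
      (∀ i, IsBandTest N (g i)) →
      Measure.map (fun u : Torus.energySpace (Fin 3) => fun i => Torus.pairing u.1 (fun x => g i (x + a))) μ₀ =
        Measure.map (fun u : Torus.energySpace (Fin 3) => fun i => Torus.pairing u.1 (g i)) μ₀) →
    (Integrable (fun u : Torus.energySpace (Fin 3) => Torus.nsGeneratorPairing ν f u
        (Torus.fourierTruncate N (u.1 : UnitAddTorus (Fin 3) → EuclideanSpace ℝ (Fin 3)))) μ₀ ∧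
      ∫ u : Torus.energySpace (Fin 3), Torus.nsGeneratorPairing ν f u
        (Torus.fourierTruncate N (u.1 : UnitAddTorus (Fin 3) → EuclideanSpace ℝ (Fin 3))) ∂μ₀ = 0) →
    (Integrable (fun u : Torus.energySpace (Fin 3) => Torus.nsGeneratorPairing ν f u
        (BDSV.curl (Torus.fourierTruncate N (u.1 : UnitAddTorus (Fin 3) → EuclideanSpace ℝ (Fin 3))))) μ₀ ∧
      ∫ u : Torus.energySpace (Fin 3), Torus.nsGeneratorPairing ν f u
        (BDSV.curl (Torus.fourierTruncate N (u.1 : UnitAddTorus (Fin 3) → EuclideanSpace ℝ (Fin 3)))) ∂μ₀ = 0) →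
    (∀ (m : ℕ) (g : Fin m → UnitAddTorus (Fin 3) → EuclideanSpace ℝ (Fin 3))
      (P : MvPolynomial (Fin m) ℝ), (∀ i, IsBandTest N (g i)) → P.IsHomogeneous 2 →
      (∀ a : UnitAddTorus (Fin 3), a 1 = 0 → L • a = 0 → ∀ u : Torus.energySpace (Fin 3), IsLevel N u →
        MvPolynomial.eval (fun j => Torus.pairing u.1 (fun x => g j (x + a))) P =
          MvPolynomial.eval (fun j => Torus.pairing u.1 (g j)) P) →
      (∀ u : Torus.energySpace (Fin 3), IsLevel N u →
        Torus.nsGeneratorPairing (d := Fin 3) 0 0 u (polyGrad g P u) = 0) →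
      ∃ α β : ℝ, ∀ u : Torus.energySpace (Fin 3), IsLevel N u →
        ∀ x, polyGrad g P u x =
          (2 * α) • Torus.fourierTruncate N (u.1 : UnitAddTorus (Fin 3) → EuclideanSpace ℝ (Fin 3)) x +
          (2 * β) • BDSV.curl (Torus.fourierTruncate N
            (u.1 : UnitAddTorus (Fin 3) → EuclideanSpace ℝ (Fin 3))) x) →
    ∀ (m : ℕ) (g : Fin m → UnitAddTorus (Fin 3) → EuclideanSpace ℝ (Fin 3))
      (P : MvPolynomial (Fin m) ℝ), (∀ i, IsBandTest N (g i)) → P.IsHomogeneous 2 →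
      (∀ u : Torus.energySpace (Fin 3), IsLevel N u →
        Torus.nsGeneratorPairing (d := Fin 3) 0 0 u (polyGrad g P u) = 0) →
      Integrable (fun u : Torus.energySpace (Fin 3) => Torus.nsGeneratorPairing ν f u (polyGrad g P u)) μ₀ ∧
      ∫ u, Torus.nsGeneratorPairing ν f u (polyGrad g P u) ∂μ₀ = 0 :=
  fun ν f N L μ₀ hf hfsym hNL =>
    axisSectors_axialDefect ν f N L μ₀ hf hfsym (lt_of_le_of_lt (Nat.zero_le _) hNL)

end Summit.AnomalousDissipation.AnomalousDissipation.Theorems.MomentParityQuarticGate
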